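import Mathlib
import Summits.PneNP.PneNP.Theorems.SymmetryBudgetWindowBarrierMonadicGuess

/-!
# Materialisation of monadic guesses — fooling pairs agree on all materialised monadic tests
(crux `SymmetryBudget.WindowBarrier`, item stmt-PneNP-2145; registered stub `stub_monadicTests`)

Corollary of `stub_monadicGuess` (`SymmetryBudgetWindowBarrierMonadicGuess.lean`): if two matrices
`x, y` agree on every square-symmetric `tcBasis`-circuit with at most `2^g · s + 3` gates, then for
every `tcBasis`-circuit `C` of size `≤ s` on matrix-plus-point inputs that is symmetric over
`(σ × σ) ⊕ σ` for all `σ`, the monadic tests `[∃ S, C(x, 1_S)]` and `[∃ S, C(y, 1_S)]` agree — the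
necessary condition every fooling pair for S4 / (★) CoreFooling must pass (CFI-type witnesses fail
it: a global section is one monadic guess).  No definitions.
-/

-- `Summit.PneNP.PneNP.…` duplicates `PneNP` BY DESIGN (single-problem summit).
set_option linter.dupNamespace false

namespace Summit.PneNP.PneNP.Theorems

open Literature.Computability.Complexity
open scoped Classical

/-- **Registered stub `stub_monadicTests`** (crux stmt-PneNP-2145): pairs fooling all
square-symmetric `tcBasis`-circuits of size `≤ 2^g · s + 3` agree on every materialised monadic
test of a template of size `≤ s` (materialise the guess by `stub_monadicGuess`, then apply the
fooling hypothesis to the materialised circuit and compare the two `decide`s). -/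
theorem stub_monadicTests : ∀ (g s : ℕ) (x y : Fin g × Fin g → Bool),
    (∀ D : Circuit (Fin g × Fin g), D.IsOver tcBasis → D.size ≤ 2 ^ g * s + 3 →
      D.IsSymmetricUnder Set.univ → D.eval x = D.eval y) →
    ∀ (C : Circuit ((Fin g × Fin g) ⊕ Fin g)), C.IsOver tcBasis → C.size ≤ s →
      (∀ σ : Equiv.Perm (Fin g), ∃ τ : Equiv.Perm (Fin C.gates.length),
        C.IsInducedAut (Sum.map (fun p : Fin g × Fin g => (σ p.1, σ p.2)) σ) τ) →
      ((∃ S : Finset (Fin g), C.eval (Sum.elim x fun u => decide (u ∈ S)) = true) ↔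
        (∃ S : Finset (Fin g), C.eval (Sum.elim y fun u => decide (u ∈ S)) = true)) := by
  intro g s x y hfool C hC hs hsym
  obtain ⟨D, hDB, hDsize, hDsym, hDeval⟩ := stub_monadicGuess g C hC hsym
  have hle : D.size ≤ 2 ^ g * s + 3 := by
    rw [hDsize]
    exact Nat.add_le_add_right (Nat.mul_le_mul_left _ hs) 3
  have h := hfool D hDB hle hDsym
  rw [hDeval x, hDeval y] at h
  exact decide_eq_decide.1 h

end Summit.PneNP.PneNP.Theorems
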